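import Summits.HodgeConjecture.HodgeConjecture.Theorems.SixfoldTableXCensusUnitaryGeneralRow
import Literature.AlgebraicGeometry.HodgeTheory.QuarticCMHodgeGroupPowersHodgeClasses
import HarnessLib

/-!
# TABLE X (dimension 6) — row 10 `g6.IV(2,1).other` (`End⁰ = E` a QUARTIC CM field, `dim_E H¹ = 3`), the GENERAL MEMBER
# (`Hg = U_E`, Lie form `hU` DISPLAYED): the census nodes X2 / X1 DISCHARGED IN THE KERNEL on the whole isogeny class, from
# the tree theorem `AbelianVariety.isDivisorGenerated_of_hodgeLieC_quarticCM` (MZ99 (1.8) ⟹ for `D = E`, Hazama / Murty)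
# (cell `pub-hodgeav-hg6`, req-37 (A) Q2b; eng-4 g5, lead g2 GO 2026-08-28T21:49:30Z condition (v) / 22:13:02Z)

HONEST FRAMING. HC, `HC_AV` (stmt-1333), `HC_CM` (stmt-3052) and the rung H2 are NOT proved and do not occur here. The
census nodes `TableX.SixfoldCodimTwoCensus` (X2) / `TableX.SixfoldCodimThreeCensus` (X1) of `SixfoldTableXCover` are OURS
(`@[conjecture]`), never asserted. KERNEL ONLY: theorems over existing declarations; no definition, no `sorry`, no named
fact; typed ≠ proved. **General member only: hU is the Lie form of Hg = U_E (MZ99 Table 1 row IV(2,1) ‘general’); the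
special members (Hg ⊊ U_E) are NOT covered; HC ∕ HC_AV NOT proved.**

WHY THIS MODULE (census-node self-audit, axis A7, continued). The A7 inventory (HOME/jobs/A7-inventory-eng4g4 §1 row 10)
recorded row 10 as «NOT on A7. Missing: dim_E = 3 analogue (“End⁰ = quartic CM E, …, Hg = U_E ⟹ B = D”); all-member version
not expected (general member row)»; the tree's unconditional theorem of this shape, `isDivisorGenerated_of_quarticCM`, is
for FOURFOLDS (signature `{(1,1),(2,0)}`, Lie step proved). The Literature lane now holds the COLOURED multiplicity-free
socket (this cell's G2: `CMHodgeGroupSlotsHodgeClasses` / `CMHodgeGroupDualBases` / `CMHodgeGroupPowersHodgeClasses`) and its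
quartic geometric end `AbelianVariety.isDivisorGenerated_of_hodgeLieC_quarticCM` (`QuarticCMHodgeGroupPowersHodgeClasses`):
for `finrank_ℚ End⁰(B) = 4`, `φ ∈ End(B)` with eigenvalues `μ₁, conj μ₁, μ₂, conj μ₂` pairwise distinct,
`eigenMultiplicity B φ μ_k + eigenMultiplicity B φ (conj μ_k) = n₀` (`k = 1,2`), `0 < n₀`, `dim B = 2n₀`, a polarization `ψ`
of `H¹(B(ℂ); ℚ)` and
  `hU`: every `(φ^*)_ℂ`-commuting `ψ_ℂ`-skew operator of `H¹(B(ℂ); ℂ)` lies in `Lie Hg(H¹(B)) ⊗ ℂ`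
(`Lie Hg ⊗ ℂ = 𝔲_E ⊗ ℂ ≅ 𝔤𝔩(W_{μ₁}) × 𝔤𝔩(W_{μ₂})`, i.e. `Hg(B) = U_E(V,ψ)`), `B = D` holds on `B` and on every abelian variety
with slots over `B`. THIS FILE feeds it into L10's entry point `SimpleRows.census_of_isIsogenous_of_isDivisorGenerated`,
with `hU` carried VERBATIM (spelled `haveI : HodgeTensorFacts := hodgeTensorFacts_holds; ∀ Y, …` as in L13):
* §1 `census_of_isIsogenous_quarticGeneral` (any `n₀`), `hodgeConjectureFor_of_isIsogenous_quarticGeneral` (L6's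
  conclusion on the isogeny class under `hU`; on `B` and its powers it is the tree's
  `hodgeConjectureFor_powSucc_of_hodgeLieC_quarticCM` BY NAME).
* §2 `census_row10_quarticGeneral` — TABLE X row 10, GENERAL MEMBER, KERNEL VERDICT under `hU` (`n₀ = 3`, `dim B = 6`,
  `B` simple): every `A ∼ B` is IN THE NODES' DOMAIN `dim A = 6 ∧ ¬ 𝒞 A` (hU-free: `B` simple by hypothesis and not of CM
  type since `dim_ℚ End⁰(B) = 4 < 12`, L10 `offResidueSix_of_isIsogenous_of_isSimple_of_not_isOfCMType`) AND satisfies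
  X2-at-`A` ∧ X1-at-`A`; `census_row10_quarticGeneral_self`.

READING (honest scope). The signature is not fixed: `(2,1;2,1)`, `(2,1;1,2)`, `(3,0;2,1)`, … all have `n₀ = 3`; `hU`
does the work and holds for the GENERAL member of row 10 (MZ99 Table 1); members with `Hg ⊊ U_E` (e.g. row 11, `E ∋ k`
acting `(3,3)`: Weil carrier, `hU` fails) are NOT covered. Without simplicity the same hypotheses also describe
`X₁ × X₂`, `X_i` non-isogenous type IV(2,1) threefolds with different imaginary quadratic fields (`End⁰ = k₁ × k₂`) — §1
applies to them verbatim (row 28 members); §2 asks `B` simple, which is row 10. No inhabitant is exhibited and none is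
invented here.

All declarations live in the sub-namespace `TableX.TypeIVRows` (lead g2 DEDUP RULE: import L10/L11/L13 entry points,
restate nothing). Nothing here is a corollary of `HC_CM`; no hypothesis of the cover is discharged GLOBALLY (X2 / X1
quantify over ALL off-residue sixfolds and stay `@[conjecture]`); typed ≠ proved.
-/

set_option linter.dupNamespace false

noncomputable section

open scoped TensorProduct
open CategoryTheory
open Literature.AlgebraicGeometry Literature.AlgebraicGeometry.Motives
open Literature.AlgebraicGeometry.Motives.AbelianVariety (IsIsogenous IsSimple)
open Literature.AlgebraicGeometry.HodgeTheory
open Literature.AlgebraicGeometry.Milne1999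
open Literature.AlgebraicTopology.SingularHomology
open Literature.Barriers.HodgeConjecture
open Summit.HodgeConjecture.HodgeConjecture.Ring2.ClassTargets
open Summit.HodgeConjecture.HodgeConjecture.Ring2.Motiv (ProdCMCell)
open Summit.HodgeConjecture.HodgeConjecture.Ring2.Atlas (IsQuarticFieldTypeIVFourfold)
open Summit.HodgeConjecture.HodgeConjecture.TableX.SimpleRows

namespace Summit.HodgeConjecture.HodgeConjecture.TableX.TypeIVRows

/-! ## §1 Quartic CM centre with `Hg = U_E` (Lie form `hU`), any `n₀`: both census conclusions on the isogeny class -/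

/-- **Both census conclusions X2-at-`A`, X1-at-`A` at every `A` isogenous to a complex abelian variety `B` with
`End⁰(B) = ℚ(φ)` of `ℚ`-dimension `4` (eigenvalue pairs of total multiplicity `n₀`, `dim B = 2n₀`) and `Hg(B) = U_E` in
the Lie form `hU`**: `B = D` on `B` is the tree's `AbelianVariety.isDivisorGenerated_of_hodgeLieC_quarticCM` (MZ99 (1.8) ⟹
for `D = E`: «`Hg(X) = Sp_D(V,φ)` ⟹ `D(Xⁿ) = B(Xⁿ)` for all `n`», Hazama / Murty), transported by L10's
`census_of_isIsogenous_of_isDivisorGenerated`. General member only: hU is the Lie form of Hg = U_E; the special members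
(Hg ⊊ U_E) are NOT covered; HC ∕ HC_AV NOT proved. [cite: MoonenZarhin1999LowDim, §1 (1.8), §2 (2.3)–(2.4) and §5 (5.1)]
[cite: Milne1999LefschetzClasses, Prop. 3.6 (c)] [cite: vanGeemen1994HodgeAV, §2.4–2.5 and Lemma 3.7] -/
theorem census_of_isIsogenous_quarticGeneral {A B : AbelianVariety ℂ} (φ : B ⟶ B)
    (hE4 : Module.finrank ℚ B.endAlgebra = 4) {μ₁ μ₂ : ℂ} (h11 : starRingEnd ℂ μ₁ ≠ μ₁) (h22 : starRingEnd ℂ μ₂ ≠ μ₂)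
    (h12 : μ₂ ≠ μ₁) (h12' : μ₂ ≠ starRingEnd ℂ μ₁) {n₀ : ℕ} (hn₀ : 0 < n₀)
    (h1 : eigenMultiplicity B φ μ₁ + eigenMultiplicity B φ (starRingEnd ℂ μ₁) = n₀)
    (h2 : eigenMultiplicity B φ μ₂ + eigenMultiplicity B φ (starRingEnd ℂ μ₂) = n₀) (hdim : B.dim = 2 * n₀)
    (hHD : exists_isReal_hodgeModel) (hI : hodgePQ_independent_of_hodgeModel)
    (ψ : (BettiUniverse.hodge hHD (AbelianVariety.isSmoothProjective_holds (A := B)) 1).Polarization)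
    (hU : haveI : HodgeTensorFacts.{0, 0} := hodgeTensorFacts_holds
      ∀ Y : Module.End ℂ (ℂ ⊗[ℚ] bettiCohomology B.X 1),
        Y * ((bettiCohomology.map φ.hom.hom.hom 1).hom).baseChange ℂ =
            ((bettiCohomology.map φ.hom.hom.hom 1).hom).baseChange ℂ * Y →
          (∀ x y, ψ.form.baseChange ℂ (Y x) y + ψ.form.baseChange ℂ x (Y y) = 0) →
            Y ∈ (BettiUniverse.hodge hHD (AbelianVariety.isSmoothProjective_holds (A := B)) 1).hodgeLieC)
    (hAB : IsIsogenous A B) :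
    (∀ c : complexBetti A.X (2 * 2), IsRationalClass c → IsOfHodgeType A.dim A.X (2 * 2) 2 2 c →
      c ∈ divisorClassesSpan A.X A.dim 2 ⊔ Submodule.span ℂ {w' : complexBetti A.X (2 * 2) |
        ∃ (C : AbelianVariety ℂ) (g : A.X ⟶ C.X) (w : complexBetti C.X (2 * 2)), C.dim < A.dim ∧
          IsRationalClass w ∧ IsOfHodgeType C.dim C.X (2 * 2) 2 2 w ∧ w' = complexBetti.map g (2 * 2) w}) ∧
    (∀ c : complexBetti A.X (2 * 3), IsRationalClass c → IsOfHodgeType A.dim A.X (2 * 3) 3 3 c →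
      c ∈ divisorClassesSpan A.X A.dim 3 ⊔ Submodule.span ℂ {w' : complexBetti A.X (2 * 3) |
          ∃ (a : complexBetti A.X (2 * 2)) (b : complexBetti A.X (2 * 1)),
            IsRationalClass a ∧ IsOfHodgeType A.dim A.X (2 * 2) 2 2 a ∧ IsRationalClass b ∧
            IsOfHodgeType A.dim A.X (2 * 1) 1 1 b ∧ w' = cupProduct (two_mul_add_two_mul 2 1) a b} ⊔
        Submodule.span ℂ {w' : complexBetti A.X (2 * 3) |
          ∃ (C : AbelianVariety ℂ) (g : A.X ⟶ C.X) (w : complexBetti C.X (2 * 3)), C.dim < A.dim ∧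
            IsRationalClass w ∧ IsOfHodgeType C.dim C.X (2 * 3) 3 3 w ∧ w' = complexBetti.map g (2 * 3) w} ⊔
        Submodule.span ℂ {w' : complexBetti A.X (2 * 3) |
          ∃ (B' : AbelianVariety ℂ) (g : A.X ⟶ B'.X) (d : ℕ) (ψ : B' ⟶ B') (w : complexBetti B'.X (2 * 3)),
            B'.dim = 6 ∧ 0 < d ∧ ψ ≫ ψ = -(d • 𝟙 B') ∧ IsRationalClass w ∧
            IsOfHodgeType B'.dim B'.X (2 * 3) 3 3 w ∧ w ∈ weilClassesOf B' ψ 3 d ∧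
            w' = complexBetti.map g (2 * 3) w}) :=
  haveI : HodgeTensorFacts.{0, 0} := hodgeTensorFacts_holds
  census_of_isIsogenous_of_isDivisorGenerated hAB
    (AbelianVariety.isDivisorGenerated_of_hodgeLieC_quarticCM B φ hE4 h11 h22 h12 h12' hn₀ h1 h2 hdim hHD hI ψ hU)

/-- **L6's CONCLUSION on the isogeny class under `hU`: the Hodge conjecture holds for every complex abelian variety
isogenous to a `B` with quartic CM centre `ℚ(φ)` and `Hg(B) = U_E`** (`B = D` on the model, transported by
`hodgeConjectureFor_of_isIsogenous_of_isDivisorGenerated`; on `B` and its powers this is the tree's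
`hodgeConjectureFor_powSucc_of_hodgeLieC_quarticCM` by name). None of Markman₄ / Markman₆ / R-W6 / X2 / X1 / `HC_CM` enters;
`hU` is displayed, never discharged. General member only: hU is the Lie form of Hg = U_E; the special members (Hg ⊊ U_E)
are NOT covered; HC ∕ HC_AV NOT proved. [cite: MoonenZarhin1999LowDim, §1 (1.7)–(1.8)] [cite: vanGeemen1994HodgeAV, §2.4 and Lemma 3.7] -/
theorem hodgeConjectureFor_of_isIsogenous_quarticGeneral {A B : AbelianVariety ℂ} (φ : B ⟶ B)
    (hE4 : Module.finrank ℚ B.endAlgebra = 4) {μ₁ μ₂ : ℂ} (h11 : starRingEnd ℂ μ₁ ≠ μ₁) (h22 : starRingEnd ℂ μ₂ ≠ μ₂)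
    (h12 : μ₂ ≠ μ₁) (h12' : μ₂ ≠ starRingEnd ℂ μ₁) {n₀ : ℕ} (hn₀ : 0 < n₀)
    (h1 : eigenMultiplicity B φ μ₁ + eigenMultiplicity B φ (starRingEnd ℂ μ₁) = n₀)
    (h2 : eigenMultiplicity B φ μ₂ + eigenMultiplicity B φ (starRingEnd ℂ μ₂) = n₀) (hdim : B.dim = 2 * n₀)
    (hHD : exists_isReal_hodgeModel) (hI : hodgePQ_independent_of_hodgeModel)
    (ψ : (BettiUniverse.hodge hHD (AbelianVariety.isSmoothProjective_holds (A := B)) 1).Polarization)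
    (hU : haveI : HodgeTensorFacts.{0, 0} := hodgeTensorFacts_holds
      ∀ Y : Module.End ℂ (ℂ ⊗[ℚ] bettiCohomology B.X 1),
        Y * ((bettiCohomology.map φ.hom.hom.hom 1).hom).baseChange ℂ =
            ((bettiCohomology.map φ.hom.hom.hom 1).hom).baseChange ℂ * Y →
          (∀ x y, ψ.form.baseChange ℂ (Y x) y + ψ.form.baseChange ℂ x (Y y) = 0) →
            Y ∈ (BettiUniverse.hodge hHD (AbelianVariety.isSmoothProjective_holds (A := B)) 1).hodgeLieC)
    (hAB : IsIsogenous A B) : HodgeConjectureFor A.dim A.X :=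
  haveI : HodgeTensorFacts.{0, 0} := hodgeTensorFacts_holds
  hodgeConjectureFor_of_isIsogenous_of_isDivisorGenerated hAB
    (AbelianVariety.isDivisorGenerated_of_hodgeLieC_quarticCM B φ hE4 h11 h22 h12 h12' hn₀ h1 h2 hdim hHD hI ψ hU)

/-! ## §2 TABLE X row 10 `g6.IV(2,1).other`, GENERAL MEMBER (`Hg = U_E`): kernel verdict with domain membership -/

/-- **TABLE X ROW 10 `g6.IV(2,1).other`, GENERAL MEMBER — KERNEL VERDICT on the whole isogeny class under `hU`.** For a
SIMPLE complex abelian SIXFOLD `B` with `finrank_ℚ End⁰(B) = 4` and `φ ∈ End(B)` whose eigenvalues `μ₁, conj μ₁, μ₂, conj μ₂`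
on `H¹(B)` are pairwise distinct with `eigenMultiplicity B φ μ_k + eigenMultiplicity B φ (conj μ_k) = 3` (`k = 1, 2`) — so
`E = End⁰(B) = ℚ(φ)` is a quartic CM field with `dim_E H¹(B;ℚ) = 3` —, a polarization `ψ` of `H¹(B(ℂ); ℚ)` and
`Hg(B) = U_E(V,ψ)` in the Lie form `hU`, and for every `A` isogenous to `B`: `dim A = 6` and `A` is OFF the residue class
`𝒞` (hU-free: `B` simple, and not of CM type since `dim_ℚ End⁰(B) = 4 < 12`), AND both census conclusions X2-at-`A`,
X1-at-`A` hold (§1). General member only: hU is the Lie form of Hg = U_E (MZ99 Table 1 row IV(2,1) ‘general’); the special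
members (Hg ⊊ U_E) are NOT covered; HC ∕ HC_AV NOT proved. [cite: MoonenZarhin1999LowDim, §1 (1.8), §2 (2.3)–(2.4) and §5 (5.1)]
[cite: vanGeemen1994HodgeAV, Lemma 3.7] [cite: MumfordAV1970, §19 Cor. 2 of Thm. 1 (p. 174)] [cite: Milne1999, §2 p. 54] -/
theorem census_row10_quarticGeneral {A B : AbelianVariety ℂ} (hB : B.dim = 6) (hBs : B.IsSimple) (φ : B ⟶ B)
    (hE4 : Module.finrank ℚ B.endAlgebra = 4) {μ₁ μ₂ : ℂ} (h11 : starRingEnd ℂ μ₁ ≠ μ₁) (h22 : starRingEnd ℂ μ₂ ≠ μ₂)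
    (h12 : μ₂ ≠ μ₁) (h12' : μ₂ ≠ starRingEnd ℂ μ₁)
    (h1 : eigenMultiplicity B φ μ₁ + eigenMultiplicity B φ (starRingEnd ℂ μ₁) = 3)
    (h2 : eigenMultiplicity B φ μ₂ + eigenMultiplicity B φ (starRingEnd ℂ μ₂) = 3)
    (hHD : exists_isReal_hodgeModel) (hI : hodgePQ_independent_of_hodgeModel)
    (ψ : (BettiUniverse.hodge hHD (AbelianVariety.isSmoothProjective_holds (A := B)) 1).Polarization)
    (hU : haveI : HodgeTensorFacts.{0, 0} := hodgeTensorFacts_holds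
      ∀ Y : Module.End ℂ (ℂ ⊗[ℚ] bettiCohomology B.X 1),
        Y * ((bettiCohomology.map φ.hom.hom.hom 1).hom).baseChange ℂ =
            ((bettiCohomology.map φ.hom.hom.hom 1).hom).baseChange ℂ * Y →
          (∀ x y, ψ.form.baseChange ℂ (Y x) y + ψ.form.baseChange ℂ x (Y y) = 0) →
            Y ∈ (BettiUniverse.hodge hHD (AbelianVariety.isSmoothProjective_holds (A := B)) 1).hodgeLieC)
    (hAB : IsIsogenous A B) :
    (A.dim = 6 ∧ ¬ (IsOfCMType A ∨ ProdCMCell IsQuarticFieldTypeIVFourfold (fun Z ↦ Z.dim = 2) A)) ∧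
    (∀ c : complexBetti A.X (2 * 2), IsRationalClass c → IsOfHodgeType A.dim A.X (2 * 2) 2 2 c →
      c ∈ divisorClassesSpan A.X A.dim 2 ⊔ Submodule.span ℂ {w' : complexBetti A.X (2 * 2) |
        ∃ (C : AbelianVariety ℂ) (g : A.X ⟶ C.X) (w : complexBetti C.X (2 * 2)), C.dim < A.dim ∧
          IsRationalClass w ∧ IsOfHodgeType C.dim C.X (2 * 2) 2 2 w ∧ w' = complexBetti.map g (2 * 2) w}) ∧
    (∀ c : complexBetti A.X (2 * 3), IsRationalClass c → IsOfHodgeType A.dim A.X (2 * 3) 3 3 c →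
      c ∈ divisorClassesSpan A.X A.dim 3 ⊔ Submodule.span ℂ {w' : complexBetti A.X (2 * 3) |
          ∃ (a : complexBetti A.X (2 * 2)) (b : complexBetti A.X (2 * 1)),
            IsRationalClass a ∧ IsOfHodgeType A.dim A.X (2 * 2) 2 2 a ∧ IsRationalClass b ∧
            IsOfHodgeType A.dim A.X (2 * 1) 1 1 b ∧ w' = cupProduct (two_mul_add_two_mul 2 1) a b} ⊔
        Submodule.span ℂ {w' : complexBetti A.X (2 * 3) |
          ∃ (C : AbelianVariety ℂ) (g : A.X ⟶ C.X) (w : complexBetti C.X (2 * 3)), C.dim < A.dim ∧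
            IsRationalClass w ∧ IsOfHodgeType C.dim C.X (2 * 3) 3 3 w ∧ w' = complexBetti.map g (2 * 3) w} ⊔
        Submodule.span ℂ {w' : complexBetti A.X (2 * 3) |
          ∃ (B' : AbelianVariety ℂ) (g : A.X ⟶ B'.X) (d : ℕ) (ψ : B' ⟶ B') (w : complexBetti B'.X (2 * 3)),
            B'.dim = 6 ∧ 0 < d ∧ ψ ≫ ψ = -(d • 𝟙 B') ∧ IsRationalClass w ∧
            IsOfHodgeType B'.dim B'.X (2 * 3) 3 3 w ∧ w ∈ weilClassesOf B' ψ 3 d ∧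
            w' = complexBetti.map g (2 * 3) w}) :=
  ⟨offResidueSix_of_isIsogenous_of_isSimple_of_not_isOfCMType hAB hB hBs
      (not_isOfCMType_of_finrank_endAlgebra_lt_two_mul_dim (by omega)),
    census_of_isIsogenous_quarticGeneral φ hE4 h11 h22 h12 h12' (by norm_num) h1 h2 (by omega) hHD hI ψ hU hAB⟩

/-- **Row 10, general member, the model itself**: `B` is in the nodes' domain and satisfies X2-at-`B` ∧ X1-at-`B` under
`hU` (the case `A = B` of `census_row10_quarticGeneral`). General member only: hU is the Lie form of Hg = U_E; the special
members (Hg ⊊ U_E) are NOT covered; HC ∕ HC_AV NOT proved. [cite: MoonenZarhin1999LowDim, §1 (1.8) and §2 (2.3)] -/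
theorem census_row10_quarticGeneral_self {B : AbelianVariety ℂ} (hB : B.dim = 6) (hBs : B.IsSimple) (φ : B ⟶ B)
    (hE4 : Module.finrank ℚ B.endAlgebra = 4) {μ₁ μ₂ : ℂ} (h11 : starRingEnd ℂ μ₁ ≠ μ₁) (h22 : starRingEnd ℂ μ₂ ≠ μ₂)
    (h12 : μ₂ ≠ μ₁) (h12' : μ₂ ≠ starRingEnd ℂ μ₁)
    (h1 : eigenMultiplicity B φ μ₁ + eigenMultiplicity B φ (starRingEnd ℂ μ₁) = 3)
    (h2 : eigenMultiplicity B φ μ₂ + eigenMultiplicity B φ (starRingEnd ℂ μ₂) = 3)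
    (hHD : exists_isReal_hodgeModel) (hI : hodgePQ_independent_of_hodgeModel)
    (ψ : (BettiUniverse.hodge hHD (AbelianVariety.isSmoothProjective_holds (A := B)) 1).Polarization)
    (hU : haveI : HodgeTensorFacts.{0, 0} := hodgeTensorFacts_holds
      ∀ Y : Module.End ℂ (ℂ ⊗[ℚ] bettiCohomology B.X 1),
        Y * ((bettiCohomology.map φ.hom.hom.hom 1).hom).baseChange ℂ =
            ((bettiCohomology.map φ.hom.hom.hom 1).hom).baseChange ℂ * Y →
          (∀ x y, ψ.form.baseChange ℂ (Y x) y + ψ.form.baseChange ℂ x (Y y) = 0) →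
            Y ∈ (BettiUniverse.hodge hHD (AbelianVariety.isSmoothProjective_holds (A := B)) 1).hodgeLieC) :
    (B.dim = 6 ∧ ¬ (IsOfCMType B ∨ ProdCMCell IsQuarticFieldTypeIVFourfold (fun Z ↦ Z.dim = 2) B)) ∧
    (∀ c : complexBetti B.X (2 * 2), IsRationalClass c → IsOfHodgeType B.dim B.X (2 * 2) 2 2 c →
      c ∈ divisorClassesSpan B.X B.dim 2 ⊔ Submodule.span ℂ {w' : complexBetti B.X (2 * 2) |
        ∃ (C : AbelianVariety ℂ) (g : B.X ⟶ C.X) (w : complexBetti C.X (2 * 2)), C.dim < B.dim ∧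
          IsRationalClass w ∧ IsOfHodgeType C.dim C.X (2 * 2) 2 2 w ∧ w' = complexBetti.map g (2 * 2) w}) ∧
    (∀ c : complexBetti B.X (2 * 3), IsRationalClass c → IsOfHodgeType B.dim B.X (2 * 3) 3 3 c →
      c ∈ divisorClassesSpan B.X B.dim 3 ⊔ Submodule.span ℂ {w' : complexBetti B.X (2 * 3) |
          ∃ (a : complexBetti B.X (2 * 2)) (b : complexBetti B.X (2 * 1)),
            IsRationalClass a ∧ IsOfHodgeType B.dim B.X (2 * 2) 2 2 a ∧ IsRationalClass b ∧
            IsOfHodgeType B.dim B.X (2 * 1) 1 1 b ∧ w' = cupProduct (two_mul_add_two_mul 2 1) a b} ⊔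
        Submodule.span ℂ {w' : complexBetti B.X (2 * 3) |
          ∃ (C : AbelianVariety ℂ) (g : B.X ⟶ C.X) (w : complexBetti C.X (2 * 3)), C.dim < B.dim ∧
            IsRationalClass w ∧ IsOfHodgeType C.dim C.X (2 * 3) 3 3 w ∧ w' = complexBetti.map g (2 * 3) w} ⊔
        Submodule.span ℂ {w' : complexBetti B.X (2 * 3) |
          ∃ (B' : AbelianVariety ℂ) (g : B.X ⟶ B'.X) (d : ℕ) (ψ : B' ⟶ B') (w : complexBetti B'.X (2 * 3)),
            B'.dim = 6 ∧ 0 < d ∧ ψ ≫ ψ = -(d • 𝟙 B') ∧ IsRationalClass w ∧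
            IsOfHodgeType B'.dim B'.X (2 * 3) 3 3 w ∧ w ∈ weilClassesOf B' ψ 3 d ∧
            w' = complexBetti.map g (2 * 3) w}) :=
  census_row10_quarticGeneral hB hBs φ hE4 h11 h22 h12 h12' h1 h2 hHD hI ψ hU (IsIsogenous.refl B)

end Summit.HodgeConjecture.HodgeConjecture.TableX.TypeIVRows

end
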